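import Mathlib
import Summits.Ventures.PercRepro2.Harris
import Summits.Ventures.PercRepro2.BasePrime
import Summits.Ventures.PercRepro2.LocRows
import Summits.Ventures.PercRepro2.SwRow
import Summits.Ventures.PercRepro2.SwOutCube
import Summits.Ventures.PercRepro2.SwOutMixedCubeFarDefs
import Summits.Ventures.PercRepro2.SwOutBigBlockDefs

/-!
# The corrected abstract big-block lemma: the block is THREE cubes (blind cell PercRepro2,
night-4 g18, 2026-08-27; proofs/NIGHT4-G18.md §1–§2)

Vocabulary from `SwOutBigBlockDefs`: the raw cube `Pt ι κ` of colour classes around a mixed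
one-sided point, `(s, a, uP, e, f)`, the red / blue edge sets `ER` / `EB`, the first leak set `Leak`
and the escaping points `D` with their cube `esc`.  This file adds the CORRECTED leak set `Leak'`
(`Leak` plus the dead-edge leaks, NIGHT4-G17.md §4‴), the core points `Core = {a = uP = e}`, the
antipodal pair `Pair = {x, x̄}` and the property `G5` (the X-move at a dropped `P`: the arm
principle), and proves

**Theorem** `mixedCore_card_le`: for every lower set `Q` of the raw cube with `G5` and every up-set
`𝓔` of atom sets, the non-leaking part of `Q` satisfies the rigid counting inequality.

The proof: the non-leaking points are `Core ∨ D ∨ Pair` (`not_leak'_iff`), and `ER` does not see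
the coordinate `e` (`ER_eq_of_eq`), so `D01(f) = (⊥, 1, 1, 0, f)` has the profile of
`F(⊥, 1, f) = (⊥, 1, 1, 1, f)` and `x̄(f) = (⊥, 0, 1, 1, f)` the profile of `D00(f) = (⊥, 0, 1, 0, f)`.
The block of `Q` is then partitioned — profile for profile — into THREE lower sets of three cubes:

* piece A, the CORE cube `core : (s, c, f) ↦ (s, c, c, c, f)`: the core points of `Q`, plus
  `D01(f)` standing in for `F(⊥, 1, f)` when the latter is not in `Q`;
* piece B, the ESCAPING cube `esc : (t, a, f) ↦ (const t, a, !t, t, f)`: `D(1, a, f)`, the point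
  `D01(f)` when `F(⊥, 1, f) ∈ Q`, and `x̄(f)` standing in for `D00(f)`;
* piece C, the PAIR cube `pair : (t, f) ↦ (const t, t, !t, !t, f)`: `x(f)` and `D00(f)` standing in
  for `x̄(f)`.

Lowerness of the three pieces uses the order of the raw cube and `G5` three times
(`D11 ⇒ F(⊥,1)`, `D10 ⇒ x̄`, `x ⇒ D01`); each piece then satisfies the inequality by the cube
principle (`card_le_of_embed`, from `LocRows.card_inter_le_of_cube` = Harris twice), and the
three counts add up (`card_split3`).
-/

namespace Summit.Ventures.PercRepro2

namespace BigBlock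

open scoped Classical

variable {ι κ : Type*} [Fintype ι] [DecidableEq ι] [Fintype κ] [DecidableEq κ]

section Defs

variable (p : Pt ι κ)

/-- The corrected leak set: `Leak` plus the dead-edge leaks (`P` in the hull of `h` on one side while
the h-piece `A` is on the other side). -/
def Leak' : Prop :=
  Leak p ∨ ((∃ j, p.1 j = true) ∧ p.2.2.1 = true ∧ p.2.1 = false) ∨
    ((∃ j, p.1 j = false) ∧ p.2.2.1 = false ∧ p.2.1 = true)

/-- The core points: `a = uP = e`. -/
def Core : Prop := p.2.1 = p.2.2.1 ∧ p.2.2.1 = p.2.2.2.1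

/-- The antipodal pair `x = (⊤, 1, 0, 0)`, `x̄ = (⊥, 0, 1, 1)`: `s = const (!e)`, `a = !e`, `uP = e`. -/
def Pair : Prop := p.1 = (fun _ => !p.2.2.2.1) ∧ p.2.1 = !p.2.2.2.1 ∧ p.2.2.1 = p.2.2.2.1

end Defs

/-- The property `G5` (the X-move at a dropped `P`, the arm principle): `(⊤, a, 0, e, f) ∈ Q`
implies `(⊥, a, 1, e, f) ∈ Q`. -/
def G5 (Q : Set (Pt ι κ)) : Prop :=
  ∀ (a e : Bool) (f : Config κ), ((fun _ => true), a, false, e, f) ∈ Q →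
    ((fun _ => false), a, true, e, f) ∈ Q

section Basic

omit [Fintype ι] [DecidableEq ι] [Fintype κ] [DecidableEq κ] in
/-- The red edge set does not see the coordinate `e`. -/
lemma ER_eq_of_eq {p q : Pt ι κ} (hs : p.1 = q.1) (ha : p.2.1 = q.2.1) (hu : p.2.2.1 = q.2.2.1)
    (hf : p.2.2.2.2 = q.2.2.2.2) : ER p = ER q := by
  obtain ⟨s, a, uP, e, f⟩ := p
  obtain ⟨s', a', uP', e', f'⟩ := q
  simp only at hs ha hu hf
  subst hs ha hu hf
  rfl

omit [Fintype ι] [DecidableEq ι] [Fintype κ] [DecidableEq κ] in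
/-- Not leaking (corrected) is being core, escaping or one of the pair. -/
lemma not_leak'_iff (p : Pt ι κ) : ¬ Leak' p ↔ Core p ∨ D p ∨ Pair p := by
  obtain ⟨s, a, uP, e, f⟩ := p
  cases a <;> cases uP <;> cases e <;>
    simp [Leak', Leak, Core, D, Pair, eq_const_true_iff, eq_const_false_iff]

omit [Fintype ι] [DecidableEq ι] [Fintype κ] [DecidableEq κ] in
/-- Core and escaping exclude each other. -/
lemma not_Core_and_D (p : Pt ι κ) : ¬ (Core p ∧ D p) := by
  rintro ⟨⟨_, h1⟩, _, h2⟩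
  rw [h1] at h2
  cases p.2.2.2.1 <;> simp at h2

omit [Fintype ι] [DecidableEq ι] [Fintype κ] [DecidableEq κ] in
/-- Core and the pair exclude each other. -/
lemma not_Core_and_Pair (p : Pt ι κ) : ¬ (Core p ∧ Pair p) := by
  rintro ⟨⟨h1, h2⟩, _, h3, h4⟩
  rw [h4] at h1
  rw [h1] at h3
  cases p.2.2.2.1 <;> simp at h3

omit [Fintype ι] [DecidableEq ι] [Fintype κ] [DecidableEq κ] in
/-- Escaping and the pair exclude each other. -/
lemma not_D_and_Pair (p : Pt ι κ) : ¬ (D p ∧ Pair p) := by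
  rintro ⟨⟨_, h1⟩, _, _, h2⟩
  rw [h2] at h1
  cases p.2.2.2.1 <;> simp at h1

end Basic

section Cubes

/-- The core embedding `(s, c, f) ↦ (s, c, c, c, f)` (the core cube `F`). -/
def core (x : Config (ι ⊕ (Unit ⊕ κ))) : Pt ι κ :=
  (fun j => x (Sum.inl j), x (Sum.inr (Sum.inl ())), x (Sum.inr (Sum.inl ())),
    x (Sum.inr (Sum.inl ())), fun k => x (Sum.inr (Sum.inr k)))

/-- The pair embedding `(t, f) ↦ (const t, t, !t, !t, f)` (`t = true` is `x`, `t = false` is `x̄`). -/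
def pair (z : Config (Unit ⊕ κ)) : Pt ι κ :=
  (fun _ => z (Sum.inl ()), z (Sum.inl ()), !(z (Sum.inl ())), !(z (Sum.inl ())),
    fun k => z (Sum.inr k))

/-- The projection of a point onto the core cube: `(s, a, f)`. -/
def projA (p : Pt ι κ) : Config (ι ⊕ (Unit ⊕ κ)) :=
  Sum.elim p.1 (Sum.elim (fun _ => p.2.1) p.2.2.2.2)

/-- The projection of a point onto the escaping cube: `(!uP, a, f)`. -/
def projB (p : Pt ι κ) : Config (Fin 2 ⊕ κ) := Sum.elim ![!p.2.2.1, p.2.1] p.2.2.2.2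

/-- The projection of a point onto the pair cube: `(a, f)`. -/
def projC (p : Pt ι κ) : Config (Unit ⊕ κ) := Sum.elim (fun _ => p.2.1) p.2.2.2.2

omit [Fintype ι] [DecidableEq ι] [Fintype κ] [DecidableEq κ] in
/-- `core` is monotone. -/
lemma core_mono {x y : Config (ι ⊕ (Unit ⊕ κ))} (h : x ≤ y) : core x ≤ core y :=
  ⟨fun _ => h _, h _, h _, h _, fun _ => h _⟩

omit [Fintype ι] [DecidableEq ι] [Fintype κ] [DecidableEq κ] in
/-- `core` commutes with the flips. -/
lemma flipPt_core (x : Config (ι ⊕ (Unit ⊕ κ))) : flipPt (core x : Pt ι κ) = core (flipAll x) := rfl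

omit [Fintype ι] [DecidableEq ι] [Fintype κ] [DecidableEq κ] in
/-- `pair` commutes with the flips. -/
lemma flipPt_pair (z : Config (Unit ⊕ κ)) : flipPt (pair z : Pt ι κ) = pair (flipAll z) := by
  simp only [flipPt, pair, flipAll, Bool.not_not]
  rfl

omit [Fintype ι] [DecidableEq ι] [Fintype κ] [DecidableEq κ] in
/-- The projection onto the core cube inverts `core`. -/
lemma projA_core (x : Config (ι ⊕ (Unit ⊕ κ))) : projA (core x : Pt ι κ) = x := by
  funext z
  rcases z with j | (⟨⟩ | k) <;> rfl

omit [Fintype ι] [DecidableEq ι] [Fintype κ] [DecidableEq κ] in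
/-- The projection onto the escaping cube inverts `esc`. -/
lemma projB_esc (y : Config (Fin 2 ⊕ κ)) : projB (esc y : Pt ι κ) = y := by
  funext z
  rcases z with i | k
  · fin_cases i
    · simp [projB, esc]
    · rfl
  · rfl

omit [Fintype ι] [DecidableEq ι] [Fintype κ] [DecidableEq κ] in
/-- The projection onto the pair cube inverts `pair`. -/
lemma projC_pair (z : Config (Unit ⊕ κ)) : projC (pair z : Pt ι κ) = z := by
  funext w
  rcases w with ⟨⟩ | k <;> rfl

omit [Fintype ι] [DecidableEq ι] [Fintype κ] [DecidableEq κ] in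
/-- `core` after the projection, explicitly. -/
lemma core_projA (p : Pt ι κ) : core (projA p) = (p.1, p.2.1, p.2.1, p.2.1, p.2.2.2.2) := rfl

omit [Fintype ι] [DecidableEq ι] [Fintype κ] [DecidableEq κ] in
/-- `esc` after the projection, explicitly. -/
lemma esc_projB (p : Pt ι κ) :
    esc (projB p) = (((fun _ => !p.2.2.1) : Config ι), p.2.1, p.2.2.1, !p.2.2.1, p.2.2.2.2) := by
  simp only [esc, projB, Sum.elim_inl, Sum.elim_inr, Matrix.cons_val_zero, Matrix.cons_val_one,
    Bool.not_not]

omit [Fintype ι] [DecidableEq ι] [Fintype κ] [DecidableEq κ] in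
/-- `pair` after the projection, explicitly. -/
lemma pair_projC (p : Pt ι κ) :
    pair (projC p) = (((fun _ => p.2.1) : Config ι), p.2.1, !p.2.1, !p.2.1, p.2.2.2.2) := rfl

omit [Fintype ι] [DecidableEq ι] [Fintype κ] [DecidableEq κ] in
/-- The red edge set of a pair point, monotone in `(t, f)`. -/
lemma ER_pair_mono {z z' : Config (Unit ⊕ κ)} (h : z ≤ z') :
    ER (pair z : Pt ι κ) ⊆ ER (pair z') := by
  intro x hx
  simp only [ER, pair, Set.mem_union, Set.mem_image, Set.mem_setOf_eq] at hx ⊢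
  rcases hx with ((((⟨j, hj, rfl⟩ | ⟨rfl, j, hj⟩) | ⟨rfl, hp⟩) | ⟨rfl, ⟨j, hj⟩, hp⟩) | ⟨k, hk, rfl⟩)
  · exact Or.inl (Or.inl (Or.inl (Or.inl ⟨j, true_le_imp (h (Sum.inl ())) hj, rfl⟩)))
  · exact Or.inl (Or.inl (Or.inl (Or.inr ⟨rfl, j, true_le_imp (h (Sum.inl ())) hj⟩)))
  · exact Or.inl (Or.inl (Or.inr ⟨rfl, true_le_imp (h (Sum.inl ())) hp⟩))
  · exfalso
    rw [hj] at hp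
    exact absurd hp (by decide)
  · exact Or.inr ⟨k, true_le_imp (h (Sum.inr k)) hk, rfl⟩

end Cubes

section Transfer

omit [Fintype ι] [DecidableEq ι] [Fintype κ] [DecidableEq κ] in
/-- **The cube principle, transferred**: a finite set `S` of points carried injectively by `ψ` onto
a lower set of a cube `Config E'`, on which the red set is a monotone function `ER'` of the cube
point and the blue set is `ER'` of the flipped cube point, satisfies the rigid counting inequality
for every up-set `𝓔` (two Harris inequalities and the flip, `LocRows.card_inter_le_of_cube`). -/
theorem card_le_of_embed {E' : Type*} [Fintype E'] [DecidableEq E'] (S : Finset (Pt ι κ))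
    (ψ : Pt ι κ → Config E') (hinj : Set.InjOn ψ S)
    (ER' : Config E' → Set (Atom ι κ)) (hmono : Monotone ER')
    (hR : ∀ p ∈ S, ER p = ER' (ψ p)) (hB : ∀ p ∈ S, EB p = ER' (flipAll (ψ p)))
    (hL : IsLowerSet (ψ '' (S : Set (Pt ι κ))))
    {𝓔 : Set (Set (Atom ι κ))} (h𝓔 : IsUpperSet 𝓔) :
    (S.filter fun p => ER p ∈ 𝓔).card ≤ (S.filter fun p => EB p ∈ 𝓔).card := by
  have e1 : (S.filter fun p => ER p ∈ 𝓔).card =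
      (Finset.univ.filter fun x : Config E' => x ∈ ψ '' (S : Set (Pt ι κ)) ∧ ER' x ∈ 𝓔).card := by
    rw [← Finset.card_image_of_injOn (hinj.mono (by
      intro x hx
      simp only [Finset.coe_filter, Set.mem_setOf_eq] at hx
      exact hx.1))]
    congr 1
    ext x
    simp only [Finset.mem_image, Finset.mem_filter, Finset.mem_univ, true_and, Set.mem_image,
      Finset.mem_coe]
    constructor
    · rintro ⟨p, ⟨hp, hE⟩, rfl⟩
      exact ⟨⟨p, hp, rfl⟩, by rw [← hR p hp]; exact hE⟩
    · rintro ⟨⟨p, hp, rfl⟩, hE⟩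
      exact ⟨p, ⟨hp, by rw [hR p hp]; exact hE⟩, rfl⟩
  have e2 : (S.filter fun p => EB p ∈ 𝓔).card =
      (Finset.univ.filter fun x : Config E' =>
        x ∈ ψ '' (S : Set (Pt ι κ)) ∧ ER' (flipAll x) ∈ 𝓔).card := by
    rw [← Finset.card_image_of_injOn (hinj.mono (by
      intro x hx
      simp only [Finset.coe_filter, Set.mem_setOf_eq] at hx
      exact hx.1))]
    congr 1
    ext x
    simp only [Finset.mem_image, Finset.mem_filter, Finset.mem_univ, true_and, Set.mem_image,
      Finset.mem_coe]
    constructor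
    · rintro ⟨p, ⟨hp, hE⟩, rfl⟩
      exact ⟨⟨p, hp, rfl⟩, by rw [← hB p hp]; exact hE⟩
    · rintro ⟨⟨p, hp, rfl⟩, hE⟩
      exact ⟨p, ⟨hp, by rw [hB p hp]; exact hE⟩, rfl⟩
  have hA : IsUpperSet {x : Config E' | ER' x ∈ 𝓔} := by
    intro x y hle hx
    exact h𝓔 (hmono hle) hx
  have hB' : IsLowerSet {x : Config E' | ER' (flipAll x) ∈ 𝓔} := by
    intro x y hle hx
    exact h𝓔 (hmono (MixedCube.flipAll_le_flipAll' hle)) hx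
  have hAB : flipAll ⁻¹' {x : Config E' | ER' (flipAll x) ∈ 𝓔} = {x : Config E' | ER' x ∈ 𝓔} := by
    ext x
    simp only [Set.mem_preimage, Set.mem_setOf_eq, flipAll_involutive x]
  have key := LocRows.card_inter_le_of_cube hL hA hB' hAB
  rw [e1, e2]
  convert key using 2 <;> apply Finset.filter_congr <;> intro x _ <;>
    simp only [Set.mem_inter_iff, Set.mem_setOf_eq]

end Transfer

end BigBlock

end Summit.Ventures.PercRepro2
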